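import Literature.NumberTheory.Sieve.GreenTao2008SzemerediExpectation
import Literature.Combinatorics.HalesJewett.DensityHalesJewettProofs
import HarnessLib

/-!
# Green–Tao, Theorem 1.1 — the primes contain arbitrarily long arithmetic progressions (discharged)

Trunk T-SIEVE. B. Green, T. Tao, *The primes contain arbitrarily long arithmetic progressions*,
Ann. of Math. 167 (2008), 481–547, Theorem 1.1: the named fact **parity.S14**
`Literature.NumberTheory.Sieve.exists_prime_arithmetic_progression` (`ParityWave0.lean`) HOLDS.

The tree proves Green–Tao's theorem along the Conlon–Fox–Zhao route with every input discharged: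
the relative Szemerédi theorem (dense model theorem `CFZ.denseModel_holds`, counting lemma
`CFZ.relativeCounting_holds`), the pseudorandom majorant of the `W`-tricked primes
(`smoothLinearFormsEstimate_holds`, Goldston–Yıldırım-type estimates) and the assembly
(`exists_prime_arithmetic_progression_of_szemeredi`, `…_of_szemerediTheorem`); the one external
input, Szemerédi's theorem (Green–Tao: "in this paper, we must assume Szemerédi's theorem",
p. 484), is `SzemerediTheorem_holds` — proved via the density Hales–Jewett theorem
(Dodos–Kanellopoulos–Tyros 2014, with the Graham–Rothschild theorem for lines) in
`Combinatorics/HalesJewett/DensityHalesJewettProofs.lean`.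

* `Literature.Combinatorics.Additive.SzemerediTheorem_holds` — Szemerédi's theorem (the named
  fact of `Combinatorics/Additive/SzemerediTheorem.lean`), discharged here next to its only use
  (the fact's file cannot import the Hales–Jewett files without a cycle-free but heavy detour;
  the discharge is a one-liner from `DensityHalesJewett_holds` and
  `szemerediTheorem_of_densityHalesJewett`);
* `GreenTao2008.SzemerediExpectation_holds` — Green–Tao's Prop. 2.3 (the named fact of
  `GreenTao2008.lean`), discharged;
* `exists_prime_arithmetic_progression_holds` — Theorem 1.1, discharged.

## References
* B. Green, T. Tao, Ann. of Math. 167 (2008), Thm. 1.1, Prop. 2.3. [cite: GreenTaoAnnals2008]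
* E. Szemerédi, Acta Arith. 27 (1975). [cite: Szemeredi1975]
-/

/-- **Szemerédi's theorem** (E. Szemerédi 1975, Main Theorem `r_k(n) = o(n)`; the tree's named fact
`Literature.Combinatorics.Additive.SzemerediTheorem`) — DISCHARGED via the density Hales–Jewett
theorem (`DensityHalesJewett_holds`, Dodos–Kanellopoulos–Tyros 2014 with the Graham–Rothschild
theorem for lines) and Polymath's deduction `szemerediTheorem_of_densityHalesJewett`.
[cite: Szemeredi1975, Main Theorem] -/
theorem _root_.Literature.Combinatorics.Additive.SzemerediTheorem_holds :
    Literature.Combinatorics.Additive.SzemerediTheorem :=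
  Literature.Combinatorics.HalesJewett.szemerediTheorem_of_densityHalesJewett
    Literature.Combinatorics.HalesJewett.DensityHalesJewett_holds

namespace Literature.NumberTheory.Sieve

/-- **Green–Tao 2008, Proposition 2.3** (Szemerédi's theorem in expectation form; the named fact
`GreenTao2008.SzemerediExpectation`) — DISCHARGED from `SzemerediTheorem_holds` by Varnavides'
argument (`GreenTao2008.szemerediExpectation_of_szemerediTheorem`).
[cite: GreenTaoAnnals2008, Proposition 2.3] -/
theorem GreenTao2008.SzemerediExpectation_holds : GreenTao2008.SzemerediExpectation :=
  GreenTao2008.szemerediExpectation_of_szemerediTheorem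
    Literature.Combinatorics.Additive.SzemerediTheorem_holds

/-- **Green–Tao, Theorem 1.1: the primes contain arbitrarily long arithmetic progressions**
(parity.S14, the named fact `exists_prime_arithmetic_progression`) — DISCHARGED.
[cite: GreenTaoAnnals2008, Theorem 1.1] -/
theorem exists_prime_arithmetic_progression_holds : exists_prime_arithmetic_progression :=
  exists_prime_arithmetic_progression_of_szemerediTheorem
    Literature.Combinatorics.Additive.SzemerediTheorem_holds

end Literature.NumberTheory.Sieve
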